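import Mathlib
import Literature.NumberTheory.LFunctions.Zhang2022.TypedSection13
import Literature.NumberTheory.LFunctions.Zhang2022.SkeletonAssembly
import HarnessLib

/-!
# Zhang (2022) §13 p. 75, the (13.11)-estimate "via Lemma 5.9": `M(s+β₁,ψ)/M(s,ψ) ≪ log P` on `𝒥(±α)`
# (`Z22:§13.u007`, reconstructed target `U007a` of GAP G-L3t6-3) — as a kernel-checked EDGE

Topic `Literature/NumberTheory/LFunctions/Zhang2022` (Landau–Siegel audit tree; verdict-neutral).
Y. Zhang, *Discrete mean estimates and the Landau–Siegel zero*, arXiv:2211.02515v1 (2022)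
[Zhang2022LandauSiegel], §13 p. 75, last sentence (tex L3810–3817):

> `… = −(1/2π)Σ_{ψ∈Ψ₁}(∫_{𝒥(α)} − ∫_{𝒥(−α)}) M(s+β₁,ψ)/M(s,ψ) · L(s+β₂,ψ)L(1−s−β₂,ψ̄)ω(s)ds + O(ε)`,
> the right side being estimated via Lemma 5.9, 6.1 and 3.3.

The estimate "via Lemma 5.9" is not displayed in print; the typer (L3-t6, `TypedSection13.lean`
append p413496) reconstructed it as `Typed.Section13.U007a c′`: for `ψ ∈ Ψ₁`, `s = ±α + s₀ + iv`
with `|v| ≤ 𝓛₁` (i.e. on `𝒥(±α)`), `‖M(s+β₁,ψ)/M(s,ψ)‖ ≤ C log P` — recorded under GAP-LEDGER row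
G-L3t6-3 as one of three WANTED estimates behind (13.11).

**What is proved** (0 new facts, Assumption (A) unused):
`Typed.Section13.u007a_of : Skeleton.Prop22i → Skeleton.Lemma59 c′ → U007a c′`. Here `M = YL`
(§2 p. 5), so `M(s+β₁)/M(s) = (Y(s+β₁)/Y(s))·(L(s+β₁)/L(s))`; the first factor has modulus
`e^{Re η} ≤ e` by the tree's EXACT `GammaFactor.sqrt_inv_Zfac_vertical_shift`
(`Y(s+iv₁) = Y(s)e^{iv₁log(pt/2π)/2}e^{η}`, `‖η‖ ≤ (2|v₁|+14)|v₁|/(2t) ≤ 1`), and the second is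
Lemma 5.9 (`Skeleton.Lemma59 c′`, a CLAIM leaf) with clearance constant `c₀ = 1`: on `Re s = ½ ± α`
every zero `ρ` of `L(·,ψ)` has `‖s − ρ‖ ≥ α`, because a zero in `Ω` lies on `σ = ½` by Proposition
2.2 (i) (`Skeleton.Prop22i`; `ψ ∈ Ψ₁`) and a zero outside `Ω` is at distance `≥ min(½ − α, 2) ≥ α`.

WHAT THIS IS NOT: a proof of Lemma 5.9 or Proposition 2.2; the other two reconstructed estimates
(`U007b`, `U007c`) or (13.11) itself; any claim about Theorems 1–2 of the manuscript or about
Landau–Siegel zeros.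

## References

* Y. Zhang, arXiv:2211.02515v1 (2022), §13 p. 75; §5 Lemma 5.9 p. 29; §2 p. 5 (`M = YL`), (2.7),
  (2.13), Prop. 2.2 (i). [cite: Zhang2022LandauSiegel, §13 p.75]
-/

noncomputable section

open Complex Real ComplexConjugate

namespace Literature.NumberTheory.LFunctions.Zhang2022.Typed.Section13

open Skeleton GammaFactor

/-- `β₁ = iv₁`, `v₁ = α(1−5c′α𝓛)`. [cite: Zhang2022LandauSiegel, §2 (2.13)] -/
private theorem beta1_eq_v (c' : ℝ) (D : ℕ) :
    beta1 c' D = ((alpha D * (1 - 5 * c' * alpha D * ell D) : ℝ) : ℂ) * I := by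
  simp only [beta1]; push_cast; ring

/-- `α = π/𝓛⁹`. [cite: Zhang2022LandauSiegel, §2 (2.10)] -/
private theorem alpha_eq_v (D : ℕ) : alpha D = π / ell D ^ 9 := by
  rw [alpha, bigP, Real.log_exp]

/-- For `𝓛 ≥ 1`: `0 < α ≤ π/𝓛` and `|v₁| ≤ 3α(1+5π|c′|)`. [cite: Zhang2022LandauSiegel, §2 (2.10), (2.13)] -/
private theorem alpha_v1_bounds {c' : ℝ} {D : ℕ} (hℓ : 1 ≤ ell D) :
    0 < alpha D ∧ alpha D ≤ π / ell D ∧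
      |alpha D * (1 - 5 * c' * alpha D * ell D)| ≤ 3 * alpha D * (1 + 5 * π * |c'|) := by
  have hℓ0 : 0 < ell D := by linarith
  have h9 : 1 ≤ ell D ^ 9 := one_le_pow₀ hℓ
  have hα : alpha D = π / ell D ^ 9 := alpha_eq_v D
  have hαpos : 0 < alpha D := by rw [hα]; positivity
  have h8 : ell D ≤ ell D ^ 9 := by
    calc ell D = ell D ^ 1 := (pow_one _).symm
      _ ≤ ell D ^ 9 := pow_le_pow_right₀ hℓ (by norm_num)
  have hαℓ : alpha D * ell D ≤ π := by
    calc alpha D * ell D ≤ alpha D * ell D ^ 9 := by gcongr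
      _ = π := by rw [hα, div_mul_cancel₀ _ (by positivity)]
  have hαℓ0 : 0 ≤ alpha D * ell D := by positivity
  refine ⟨hαpos, by rw [le_div_iff₀ hℓ0]; exact hαℓ, ?_⟩
  have hb : |5 * c' * alpha D * ell D| ≤ 5 * π * |c'| := by
    rw [show 5 * c' * alpha D * ell D = 5 * c' * (alpha D * ell D) by ring, abs_mul, abs_mul,
      abs_of_nonneg (by norm_num : (0 : ℝ) ≤ 5), abs_of_nonneg hαℓ0]
    calc 5 * |c'| * (alpha D * ell D) ≤ 5 * |c'| * π := by gcongr
      _ = 5 * π * |c'| := by ring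
  rw [abs_mul, abs_of_nonneg hαpos.le]
  have h1 : |1 - 5 * c' * alpha D * ell D| ≤ 1 + 5 * π * |c'| := by
    calc |1 - 5 * c' * alpha D * ell D| ≤ |(1 : ℝ)| + |5 * c' * alpha D * ell D| := abs_sub _ _
      _ ≤ 1 + 5 * π * |c'| := by rw [abs_one]; linarith
  have hK0 : 0 ≤ 1 + 5 * π * |c'| := by positivity
  calc alpha D * |1 - 5 * c' * alpha D * ell D| ≤ alpha D * (1 + 5 * π * |c'|) := by gcongr
    _ ≤ 3 * alpha D * (1 + 5 * π * |c'|) := by nlinarith [mul_nonneg hαpos.le hK0]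

/-- **Lemma 5.9's clearance hypothesis on `Re s = ½ ± α`, from Proposition 2.2 (i)**: if every zero
of `L(s,ψ)L(s,ψχ)` in `Ω` has real part `½`, then for `s` with `|Re s − ½| = α`, `|Im s − 2πt₀| ≤ 𝓛₁`
and `0 < α ≤ 1/4`, every zero `ρ` of `L(·,ψ)` satisfies `α ≤ ‖s − ρ‖`.
[cite: Zhang2022LandauSiegel, §5 Lemma 5.9; §2 (2.7), Prop. 2.2 (i)] -/
theorem zero_clearance_of_re_half {D : ℕ} [NeZero D] (χ : DirichletCharacter ℂ D) (x : Chr D)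
    (h22 : ∀ s ∈ prodZeroSetOmega χ x, s.re = 1 / 2) {s : ℂ}
    (hre : |s.re - 1 / 2| = alpha D) (him : |s.im - 2 * π * t0 D| ≤ ell1 D)
    (hα0 : 0 < alpha D) (hα4 : alpha D ≤ 1 / 4) :
    ∀ ρ : ℂ, x.ψ.LFunction ρ = 0 → 1 * alpha D ≤ ‖s - ρ‖ := by
  intro ρ hρ
  rw [one_mul]
  by_cases hΩ : ρ ∈ Omega D
  · -- a zero in `Ω` lies on the critical line
    have hρre : ρ.re = 1 / 2 := h22 ρ ⟨hΩ, by rw [hρ, zero_mul]⟩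
    calc alpha D = |(s - ρ).re| := by rw [Complex.sub_re, hρre, hre]
      _ ≤ ‖s - ρ‖ := Complex.abs_re_le_norm _
  · -- a zero outside `Ω` is far away
    rw [Omega, Set.mem_setOf_eq, not_and_or, Complex.sub_re, Complex.sub_im, s0_re, s0_im] at hΩ
    rcases hΩ with h1 | h1
    · have h1' : 1 / 2 ≤ |ρ.re - 1 / 2| := not_lt.mp h1
      calc alpha D ≤ |(s - ρ).re| := by
            rw [Complex.sub_re]
            have : |ρ.re - 1 / 2| - |s.re - 1 / 2| ≤ |(s.re - 1 / 2) - (ρ.re - 1 / 2)| := by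
              rw [abs_sub_comm ((s.re - 1 / 2)) _]; exact abs_sub_abs_le_abs_sub _ _
            rw [show s.re - 1 / 2 - (ρ.re - 1 / 2) = s.re - ρ.re by ring, hre] at this
            linarith
        _ ≤ ‖s - ρ‖ := Complex.abs_re_le_norm _
    · have h1' : ell1 D + 2 ≤ |ρ.im - 2 * π * t0 D| := not_lt.mp h1
      calc alpha D ≤ |(s - ρ).im| := by
            rw [Complex.sub_im]
            have : |ρ.im - 2 * π * t0 D| - |s.im - 2 * π * t0 D| ≤
                |(s.im - 2 * π * t0 D) - (ρ.im - 2 * π * t0 D)| := by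
              rw [abs_sub_comm ((s.im - 2 * π * t0 D)) _]; exact abs_sub_abs_le_abs_sub _ _
            rw [show s.im - 2 * π * t0 D - (ρ.im - 2 * π * t0 D) = s.im - ρ.im by ring] at this
            linarith
        _ ≤ ‖s - ρ‖ := Complex.abs_im_le_norm _

/-- **`|Y(s+β₁,ψ)/Y(s,ψ)| ≤ e` as an exact factorisation**: for `ψ` primitive mod `p`, `s = σ + it`,
`0 < σ ≤ 1`, `t ≥ 8`, `|v₁| ≤ 1`: `Y(s+iv₁) = Y(s)·E` with `‖E‖ ≤ e` (tree's
`sqrt_inv_Zfac_vertical_shift`). [cite: Zhang2022LandauSiegel, §5 Lemma 5.2 (proof); §13 p.75] -/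
theorem Yroot_shift_eq_mul {D : ℕ} (x : Chr D) {σ t v : ℝ} (hσ0 : 0 < σ) (hσ1 : σ ≤ 1)
    (ht : 8 ≤ t) (hv : |v| ≤ 1) :
    ∃ E : ℂ, ‖E‖ ≤ Real.exp 1 ∧
      Yroot x.ψ ((σ : ℂ) + t * I + v * I) = Yroot x.ψ ((σ : ℂ) + t * I) * E := by
  obtain ⟨hYd, hYsq⟩ := Yroot_spec x.prim
  have ht' : 4 * (1 : ℝ) ≤ t := by linarith
  have hvt : |v| ≤ t / 2 := by linarith
  obtain ⟨η, hη, hY⟩ := sqrt_inv_Zfac_vertical_shift x.prim hYd hYsq le_rfl hσ0 hσ1 ht' hvt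
  refine ⟨cexp ((v : ℂ) * ((Real.log ((x.p : ℝ) * t / (2 * π)) : ℝ) : ℂ) / 2 * I) * cexp η, ?_, ?_⟩
  · have h0 : 0 ≤ |v| := abs_nonneg _
    have hη1 : ‖η‖ ≤ 1 := by
      refine le_trans hη ?_
      rw [div_le_one (by linarith)]
      nlinarith
    have hphase : ‖cexp ((v : ℂ) * ((Real.log ((x.p : ℝ) * t / (2 * π)) : ℝ) : ℂ) / 2 * I)‖ = 1 := by
      have : (v : ℂ) * ((Real.log ((x.p : ℝ) * t / (2 * π)) : ℝ) : ℂ) / 2 * I =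
          ((v * Real.log ((x.p : ℝ) * t / (2 * π)) / 2 : ℝ) : ℂ) * I := by push_cast; ring
      rw [this]; exact Complex.norm_exp_ofReal_mul_I _
    rw [norm_mul, hphase, one_mul]
    calc ‖cexp η‖ = Real.exp η.re := Complex.norm_exp η
      _ ≤ Real.exp 1 := Real.exp_le_exp.mpr (le_trans (Complex.re_le_norm η) hη1)
  · rw [hY]; ring

/-- **`Z22:§13.u007`, estimate "via Lemma 5.9" (`U007a`), as a kernel-checked EDGE** [Z22 p.75, tex
L3817; reconstructed target of GAP G-L3t6-3]: Proposition 2.2 (i) and Lemma 5.9 imply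
`Typed.Section13.U007a c′`: for `D` large, `ψ ∈ Ψ₁`, `s = ±α + s₀ + iv`, `|v| ≤ 𝓛₁`,
`‖M(s+β₁,ψ)/M(s,ψ)‖ ≤ C log P` with `C = e·max(C₅.₉(c₀ = 1), 0)`.
[cite: Zhang2022LandauSiegel, §13 p.75; §5 Lemma 5.9] -/
theorem u007a_of (c' : ℝ) (h22 : Prop22i) (h59 : Lemma59 c') : U007a c' := by
  obtain ⟨C₁, D₁, h59⟩ := h59 1 one_pos
  obtain ⟨D₂, h22⟩ := h22
  set K : ℝ := 1 + 5 * π * |c'| with hK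
  have hK1 : 1 ≤ K := by rw [hK]; nlinarith [pi_pos, abs_nonneg c']
  set M : ℝ := 16 + 3 * π * K with hM
  refine ⟨Real.exp 1 * max C₁ 0, max (max D₁ D₂) ⌈Real.exp M⌉₊,
    fun D _ χ hD hq hp _ x hx σ hσ v hv => ?_⟩
  have hD₁ : D₁ ≤ D := le_trans (le_trans (le_max_left _ _) (le_max_left _ _)) hD
  have hD₂ : D₂ ≤ D := le_trans (le_trans (le_max_right _ _) (le_max_left _ _)) hD
  have hDM : ⌈Real.exp M⌉₊ ≤ D := le_trans (le_max_right _ _) hD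
  -- `𝓛 ≥ M ≥ 16`
  have hDreal : Real.exp M ≤ (D : ℝ) := le_trans (Nat.le_ceil _) (by exact_mod_cast hDM)
  have hDpos : (0 : ℝ) < D := lt_of_lt_of_le (Real.exp_pos M) hDreal
  have hℓM : M ≤ ell D := by rw [ell]; exact (Real.le_log_iff_exp_le hDpos).mpr hDreal
  have hM16 : 16 ≤ M := by rw [hM]; nlinarith [pi_pos]
  have hℓ1 : 1 ≤ ell D := by linarith
  have hℓpos : 0 < ell D := by linarith
  have ht0ℓ : ell D ≤ t0 D := by rw [t0]; exact le_self_pow₀ hℓ1 (by norm_num)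
  have ht0pos : 0 < t0 D := by linarith
  have hℓ1t0 : ell1 D ≤ t0 D := by rw [ell1, t0]; exact pow_le_pow_right₀ hℓ1 (by norm_num)
  obtain ⟨hαpos, hαπℓ, hav1⟩ := alpha_v1_bounds (c' := c') hℓ1
  have h3αK : 3 * alpha D * K ≤ 1 := by
    calc 3 * alpha D * K ≤ 3 * (π / ell D) * K := by gcongr
      _ = (3 * π * K) / ell D := by ring
      _ ≤ 1 := by rw [div_le_one hℓpos]; linarith
  have hα4 : alpha D ≤ 1 / 4 := by
    have : alpha D ≤ 3 * alpha D * K := by nlinarith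
    have h2 : alpha D ≤ π / ell D := hαπℓ
    rw [le_div_iff₀ hℓpos] at h2
    nlinarith [Real.pi_lt_four]
  set v1 : ℝ := alpha D * (1 - 5 * c' * alpha D * ell D) with hv1
  have hv1small : |v1| ≤ 1 := le_trans hav1 h3αK
  -- the point `s = (1/2 + σ) + i(2πt₀ + v)`
  set s : ℂ := (σ : ℂ) + s0 D + v * I with hs
  set σ' : ℝ := 1 / 2 + σ with hσ'
  set t : ℝ := 2 * π * t0 D + v with ht
  have hs_eq : s = (σ' : ℂ) + t * I := by
    apply Complex.ext
    · simp [hs, hσ', s0_re]; ring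
    · simp [hs, ht, s0_im]
  have hsre : s.re = 1 / 2 + σ := by rw [hs_eq]; simp [hσ']
  have hsim : s.im = 2 * π * t0 D + v := by rw [hs_eq]; simp [ht]
  have hσabs : |σ| = alpha D := by
    rcases hσ with h | h
    · rw [h, abs_of_pos hαpos]
    · rw [h, abs_neg, abs_of_pos hαpos]
  have hre_abs : |s.re - 1 / 2| = alpha D := by rw [hsre, show 1 / 2 + σ - 1 / 2 = σ by ring, hσabs]
  have him_abs : |s.im - 2 * π * t0 D| ≤ ell1 D := by
    rw [hsim, show 2 * π * t0 D + v - 2 * π * t0 D = v by ring]; exact hv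
  -- Lemma 5.9 at `s`
  have hclear := zero_clearance_of_re_half χ x (h22 D χ hD₂ hq hp x hx) hre_abs him_abs hαpos hα4
  have hL := h59 D χ hD₁ hq hp x hx s hre_abs.le (by linarith [him_abs]) hclear
  have hlogP : 0 ≤ Real.log (bigP D) := by rw [bigP, Real.log_exp]; positivity
  -- the `Y`-ratio
  have hσ'0 : 0 < σ' := by
    rcases hσ with h | h <;> rw [hσ', h] <;> linarith
  have hσ'1 : σ' ≤ 1 := by
    rcases hσ with h | h <;> rw [hσ', h] <;> linarith
  have ht8 : 8 ≤ t := by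
    rw [ht]
    have := (abs_le.mp hv).1
    have hπ : (3 : ℝ) < π := Real.pi_gt_three
    nlinarith
  obtain ⟨E, hE, hYs⟩ := Yroot_shift_eq_mul x (v := v1) hσ'0 hσ'1 ht8 hv1small
  have hY0 : Yroot x.ψ ((σ' : ℂ) + t * I) ≠ 0 := by
    obtain ⟨-, hYsq⟩ := Yroot_spec x.prim
    have him0 : 0 < ((σ' : ℂ) + t * I).im := by simp; linarith
    intro h0
    have := hYsq _ him0
    rw [h0, zero_pow two_ne_zero] at this
    exact inv_ne_zero (Zfac_ne_zero x.prim him0) this.symm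
  have hβ : s + beta1 c' D = (σ' : ℂ) + t * I + (v1 : ℂ) * I := by rw [beta1_eq_v, hs_eq]
  have hratio : Mfun x.ψ (s + beta1 c' D) / Mfun x.ψ s =
      E * (x.ψ.LFunction (s + beta1 c' D) / x.ψ.LFunction s) := by
    have h1 : Mfun x.ψ (s + beta1 c' D) = Yroot x.ψ ((σ' : ℂ) + t * I) * E *
        x.ψ.LFunction (s + beta1 c' D) := by
      rw [Mfun, hβ, hYs]
    have h2 : Mfun x.ψ s = Yroot x.ψ ((σ' : ℂ) + t * I) * x.ψ.LFunction s := by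
      rw [Mfun, hs_eq]
    rw [h1, h2, mul_assoc, mul_div_mul_left _ _ hY0, mul_div_assoc]
  show ‖Mfun x.ψ (s + beta1 c' D) / Mfun x.ψ s‖ ≤ Real.exp 1 * max C₁ 0 * Real.log (bigP D)
  rw [hratio, norm_mul]
  have hL' : ‖x.ψ.LFunction (s + beta1 c' D) / x.ψ.LFunction s‖ ≤ max C₁ 0 * Real.log (bigP D) :=
    hL.trans (mul_le_mul_of_nonneg_right (le_max_left _ _) hlogP)
  calc ‖E‖ * ‖x.ψ.LFunction (s + beta1 c' D) / x.ψ.LFunction s‖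
      ≤ Real.exp 1 * (max C₁ 0 * Real.log (bigP D)) :=
        mul_le_mul hE hL' (norm_nonneg _) (Real.exp_nonneg _)
    _ = Real.exp 1 * max C₁ 0 * Real.log (bigP D) := by ring

end Literature.NumberTheory.LFunctions.Zhang2022.Typed.Section13
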